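import Summits.Schanuel.Schanuel.Theses.RootDecomp1H
import Summits.Schanuel.Schanuel.Theorems.RootDecomp1HMirrorItems

/-!
# RootDecomp1HMirrorClose — the PROVED support `ObliqueLift` of route `RootDecomp1H` rev 16–18 (ROUND 12 «Mirror», PATH A′)

The route file (writer-1 g7, 2026-08-30T16:43:19Z) types the support item `ObliqueLift` (stmt-Schanuel-27116): a nearly
conjugation-stable first failure has a conjugation-STABLE sibling of the same rank (the sibling theorem T₁ of lens-5 gen 12).
Its text is the `MirrorItems` def verbatim, proved there as `RootDecomp1HMirror.obliqueLift_holds` (p777177); this file closes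
the item BY NAME over the route decl (definitionally the same term). Sorry-free; standard axioms. Nothing here proves Schanuel; rung 0.
-/

set_option linter.dupNamespace false

namespace Summit.Schanuel.Schanuel.Theorems.RootDecomp1HMirror

/-- Route item stmt-Schanuel-27116 `ObliqueLift` — PROVED (the node theorem `obliqueLift_holds` read over the route decl). -/
theorem obliqueLift_item : Summit.Schanuel.Schanuel.Theses.RootDecomp1H.ObliqueLift :=
  obliqueLift_holds

end Summit.Schanuel.Schanuel.Theorems.RootDecomp1HMirror
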